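import Mathlib
import Summits.KontsevichZagierPeriods.Zeta5Search.LaiSavingCheck
import HarnessLib

/-!
# A fast per-cell admissibility check for the saving factor (sorted-threshold certificates)

Sub-problem `KontsevichZagierPeriods/Zeta5Search`, family `fam-indep` (linear independence /
dimension), generation 5. Systematic search; no irrationality claim unless certified.

`LaiSavingCheck.lean` makes the per-cell admissibility `SavingCell.Adm` of a `Kappa3CellCert` decidable by
a strip checker whose cost is (dividing lines) × (terms) per cell (≈ 13 s of kernel time per cell of
the κ₃ table: too slow for the ≈ 10⁵–10⁶ cells such a certificate needs). This file gives a second,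
much cheaper decision procedure for the same field, of cost (terms) × (pieces of a short
`y`-partition supplied by the certificate):

on a cell `[x₀, x₁)` on which `⌊a x⌋` (`a` a slope of the term list) is CONSTANT (`= q`, checked
from the endpoints: `q ≤ a x₁ ≤ q + 1`; a term failing the check falls back to a crude interval bound
losing at most `2|coef|`), the phase `θ(x) = a x − q ∈ [0, 1)` is affine, and for `y ∈ [0, 1)`
`⌊y − a x⌋ = −q − [y < θ(x)]`, `⌊a x − y⌋ = q − [θ(x) < y]`;
so a floor term is a constant plus a weighted threshold indicator, and on a piece `[y_k, y_{k+1})` of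
the `y`-interval it is bounded below using only the endpoint range `[θmin, θmax]` of `θ`
(`[y < θ] ≥ [y_{k+1} ≤ θmin]`, `[y < θ] ≤ [y_k < θmax]`, `[θ < y] ≥ [θmax < y_k]`,
`[θ < y] ≤ [θmin < y_{k+1}]`). Main results:
* `checkS ts a₀ b₀ a₁ b₁ c ys` / `checkS_sound : checkS … = true → a₀/b₀ ≤ x → x < a₁/b₁ → 0 ≤ y →
  y < 1 → c ≤ evalSum ts x y`;
* **`SavingCell.adm_of_checkAdmS`**: `(∀ j, 2δ_j ≤ M) → C.checkAdmS (laiTerms J r M δ) ys = true →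
  C.Adm J r M δ dmin` (the κ₃ instance over a literal term list is `LaiKappa3Terms.lean`).
Measured kernel cost (farm, `decide +kernel`, 227 terms): see `LaiKappa3Terms.lean`.

HONEST FRAMING: a checker and its soundness theorem; no cell of the κ₃ table is certified here and no
claim about `ζ(5)` or about 'κ₃ ≤ 73' is made. References: [Zudilin2004] §8 pp. 270–271;
[Lai2024BallRivoal] arXiv:2407.14236, §4 (4.5)–(4.6), Lemma 4.3.
-/

open Finset Filter
open Literature.NumberTheory.Transcendental.Zudilin2004.PhiCert

namespace Summit.KontsevichZagierPeriods.Zeta5Search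

namespace SavingScan

open SavingCheck

/-! ### Rational partition points and exact comparisons -/

/-- A rational point `p/d` of a `y`-partition (the checker verifies `0 < d`). [folklore] -/
structure QPt where
  /-- numerator -/
  p : ℤ
  /-- denominator -/
  d : ℕ
  deriving DecidableEq

/-- The value `p/d`. [folklore] -/
def QPt.val (P : QPt) : ℚ := (P.p : ℚ) / P.d

/-- `P ≤ N/b`, by cross-multiplication. [folklore] -/
def QPt.leR (P : QPt) (N : ℤ) (b : ℕ) : Bool := decide (P.p * b ≤ N * P.d)

/-- `P < N/b`, by cross-multiplication. [folklore] -/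
def QPt.ltR (P : QPt) (N : ℤ) (b : ℕ) : Bool := decide (P.p * b < N * P.d)

/-- `N/b < P`, by cross-multiplication. [folklore] -/
def QPt.gtR (P : QPt) (N : ℤ) (b : ℕ) : Bool := decide (N * P.d < P.p * b)

/-- Correctness of `QPt.leR` (positive denominators). [folklore] -/
theorem QPt.leR_iff (P : QPt) (N : ℤ) {b : ℕ} (hb : 0 < b) (hd : 0 < P.d) :
    P.leR N b = true ↔ P.val ≤ (N : ℚ) / b := by
  rw [QPt.leR, decide_eq_true_eq, QPt.val, div_le_div_iff₀ (by positivity) (by positivity)]; norm_cast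

/-- Correctness of `QPt.ltR` (positive denominators). [folklore] -/
theorem QPt.ltR_iff (P : QPt) (N : ℤ) {b : ℕ} (hb : 0 < b) (hd : 0 < P.d) :
    P.ltR N b = true ↔ P.val < (N : ℚ) / b := by
  rw [QPt.ltR, decide_eq_true_eq, QPt.val, div_lt_div_iff₀ (by positivity) (by positivity)]; norm_cast

/-- Correctness of `QPt.gtR` (positive denominators). [folklore] -/
theorem QPt.gtR_iff (P : QPt) (N : ℤ) {b : ℕ} (hb : 0 < b) (hd : 0 < P.d) :
    P.gtR N b = true ↔ (N : ℚ) / b < P.val := by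
  rw [QPt.gtR, decide_eq_true_eq, QPt.val, div_lt_div_iff₀ (by positivity) (by positivity)]; norm_cast

/-! ### Per-cell data of a floor term and the piece bound -/

/-- Per-cell data of a floor term on `[a₀/b₀, a₁/b₁)`: coefficient, kind, `q = ⌊a x₀⌋`, the numerators
of the phase at the endpoints `θ(x₀) = N₀/b₀`, `θ(x₁⁻) = N₁/b₁` (`θ(x) = a x − q`), the flag
'`⌊a x⌋` is constant on the cell' (`q ≤ a x₁ ≤ q + 1`), and the crude range `mlo ≤ ⌊a x⌋ ≤ mhi` on the
closed cell (used when the flag is `false`). [folklore] -/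
structure TRec where
  /-- coefficient -/
  coef : ℤ
  /-- kind -/
  kind : Kind
  /-- `⌊a x₀⌋` -/
  q : ℤ
  /-- `b₀ θ(x₀)` -/
  N0 : ℤ
  /-- `b₁ θ(x₁⁻)` -/
  N1 : ℤ
  /-- floor-constancy flag -/
  ok : Bool
  /-- `min (⌊a x₀⌋) (⌊a x₁⌋)` -/
  mlo : ℤ
  /-- `max (⌊a x₀⌋) (⌊a x₁⌋)` -/
  mhi : ℤ

/-- Compute the per-cell data of a term. [folklore] -/
def prepTerm (T : Term) (a0 : ℤ) (b0 : ℕ) (a1 : ℤ) (b1 : ℕ) : TRec :=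
  let q := fl (T.a * a0) b0
  let q1 := fl (T.a * a1) b1
  ⟨T.coef, T.kind, q, T.a * a0 - q * b0, T.a * a1 - q * b1,
    decide (q * b1 ≤ T.a * a1) && decide (T.a * a1 ≤ (q + 1) * b1), min q q1, max q q1⟩

/-- Crude lower bound of a floor term on the closed cell × `[0, 1)` from `mlo ≤ ⌊a x⌋ ≤ mhi` only
(fallback when `⌊a x⌋` is not constant on the cell; loses at most `2|coef|`). [folklore] -/
def TRec.crude (R : TRec) : ℤ :=
  match R.kind with
  | .ax => if 0 ≤ R.coef then R.coef * R.mlo else R.coef * R.mhi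
  | .yax => if 0 ≤ R.coef then R.coef * (-R.mhi - 1) else R.coef * (-R.mlo)
  | .axy => if 0 ≤ R.coef then R.coef * (R.mlo - 1) else R.coef * R.mhi

/-- Lower bound of a floor term on (cell) × `[y_k, y_{k+1})` in the floor-constant case: the constant
part plus the weighted threshold indicator, decided from the endpoint range of the phase. [folklore] -/
def TRec.pbOk (R : TRec) (b0 b1 : ℕ) (yk yk1 : QPt) : ℤ :=
  match R.kind with
  | .ax => R.coef * R.q
  | .yax => -(R.coef * R.q) +
      (if R.coef ≤ 0 then (if yk1.leR R.N0 b0 && yk1.leR R.N1 b1 then -R.coef else 0)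
       else (if yk.ltR R.N0 b0 || yk.ltR R.N1 b1 then -R.coef else 0))
  | .axy => R.coef * R.q +
      (if R.coef ≤ 0 then (if yk.gtR R.N0 b0 && yk.gtR R.N1 b1 then -R.coef else 0)
       else (if yk1.gtR R.N0 b0 || yk1.gtR R.N1 b1 then -R.coef else 0))

/-- Lower bound of a floor term on (cell) × `[y_k, y_{k+1})`: the threshold bound if `⌊a x⌋` is
constant on the cell, the crude bound otherwise. [folklore] -/
def TRec.pb (R : TRec) (b0 b1 : ℕ) (yk yk1 : QPt) : ℤ :=
  if R.ok then R.pbOk b0 b1 yk yk1 else R.crude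

/-- The certified lower bound of a prepared term list on (cell) × `[y_k, y_{k+1})`. [folklore] -/
def piecePB (rs : List TRec) (b0 b1 : ℕ) (yk yk1 : QPt) : ℤ :=
  (rs.map fun R => R.pb b0 b1 yk yk1).sum

/-- Walk the `y`-partition from `y_k` upwards, checking every piece against the claimed bound `c`;
the last point must be `≥ 1`. [folklore] -/
def goS (rs : List TRec) (b0 b1 : ℕ) (c : ℤ) : QPt → List QPt → Bool
  | yk, [] => decide ((yk.d : ℤ) ≤ yk.p)
  | yk, yk1 :: rest =>
      decide (0 < yk1.d) && decide (c ≤ piecePB rs b0 b1 yk yk1) && goS rs b0 b1 c yk1 rest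

/-- **The sorted-threshold checker**: `c ≤ Σ_T T.eval x y` on `[a₀/b₀, a₁/b₁) × [0, 1)`, certified piece
by piece along the `y`-partition `ys`. [folklore] -/
def checkS (ts : List Term) (a0 : ℤ) (b0 : ℕ) (a1 : ℤ) (b1 : ℕ) (c : ℤ) (ys : List QPt) : Bool :=
  decide (0 < b0) && decide (0 < b1) && goS (ts.map fun T => prepTerm T a0 b0 a1 b1) b0 b1 c ⟨0, 1⟩ ys

/-! ### Soundness -/

/-- Floor constancy and the phase range on a cell, from the per-cell data. [folklore] -/
theorem prepTerm_spec (T : Term) {a0 a1 : ℤ} {b0 b1 : ℕ} (hb0 : 0 < b0) (hb1 : 0 < b1) {x : ℚ}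
    (hx0 : (a0 : ℚ) / b0 ≤ x) (hx1 : x < (a1 : ℚ) / b1) (hok : (prepTerm T a0 b0 a1 b1).ok = true) :
    ((prepTerm T a0 b0 a1 b1).q : ℚ) ≤ (T.a : ℚ) * x ∧ (T.a : ℚ) * x < (prepTerm T a0 b0 a1 b1).q + 1 ∧
    min (((prepTerm T a0 b0 a1 b1).N0 : ℚ) / b0) (((prepTerm T a0 b0 a1 b1).N1 : ℚ) / b1)
      ≤ (T.a : ℚ) * x - (prepTerm T a0 b0 a1 b1).q ∧
    (T.a : ℚ) * x - (prepTerm T a0 b0 a1 b1).q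
      ≤ max (((prepTerm T a0 b0 a1 b1).N0 : ℚ) / b0) (((prepTerm T a0 b0 a1 b1).N1 : ℚ) / b1) := by
  set q : ℤ := fl (T.a * a0) b0 with hq_def
  have hq : (prepTerm T a0 b0 a1 b1).q = q := rfl
  have hN0 : (((prepTerm T a0 b0 a1 b1).N0 : ℤ) : ℚ) / b0 = (T.a : ℚ) * ((a0 : ℚ) / b0) + (-(q : ℚ)) := by
    have hb : (b0 : ℚ) ≠ 0 := by positivity
    show (((T.a * a0 - q * b0 : ℤ)) : ℚ) / b0 = _
    push_cast; field_simp; ring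
  have hN1 : (((prepTerm T a0 b0 a1 b1).N1 : ℤ) : ℚ) / b1 = (T.a : ℚ) * ((a1 : ℚ) / b1) + (-(q : ℚ)) := by
    have hb : (b1 : ℚ) ≠ 0 := by positivity
    show (((T.a * a1 - q * b1 : ℤ)) : ℚ) / b1 = _
    push_cast; field_simp; ring
  have hfl0 : ⌊(T.a : ℚ) * ((a0 : ℚ) / b0)⌋ = q := by
    rw [show (T.a : ℚ) * ((a0 : ℚ) / b0) = ((T.a * a0 : ℤ) : ℚ) / (b0 : ℕ) by push_cast; ring]
    exact Rat.floor_intCast_div_natCast _ _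
  have h0lo : (q : ℚ) ≤ (T.a : ℚ) * ((a0 : ℚ) / b0) := hfl0 ▸ Int.floor_le _
  have h0hi : (T.a : ℚ) * ((a0 : ℚ) / b0) < q + 1 := hfl0 ▸ Int.lt_floor_add_one _
  have hok' : q * b1 ≤ T.a * a1 ∧ T.a * a1 ≤ (q + 1) * b1 := by
    simpa [prepTerm, Bool.and_eq_true, decide_eq_true_eq] using hok
  have hb1q : (0 : ℚ) < b1 := by exact_mod_cast hb1
  have h1lo : (q : ℚ) ≤ (T.a : ℚ) * ((a1 : ℚ) / b1) := by
    rw [← mul_div_assoc, le_div_iff₀ hb1q]; exact_mod_cast hok'.1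
  have h1hi : (T.a : ℚ) * ((a1 : ℚ) / b1) ≤ q + 1 := by
    rw [← mul_div_assoc, div_le_iff₀ hb1q]; exact_mod_cast hok'.2
  have hrange := affine_mem_of_le (α := (T.a : ℚ)) (β := -(q : ℚ)) hx0 hx1.le
  rw [hq, hN0, hN1]
  refine ⟨?_, ?_, by simpa [sub_eq_add_neg] using hrange.1, by simpa [sub_eq_add_neg] using hrange.2⟩
  · rcases le_or_gt 0 (T.a : ℚ) with ha | ha
    · exact h0lo.trans (mul_le_mul_of_nonneg_left hx0 ha)
    · exact h1lo.trans (mul_lt_mul_of_neg_left hx1 ha).le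
  · rcases lt_or_ge 0 (T.a : ℚ) with ha | ha
    · exact (mul_lt_mul_of_pos_left hx1 ha).trans_le h1hi
    · exact (mul_le_mul_of_nonpos_left hx0 ha).trans_lt h0hi

/-- `⌊y − θ⌋ = −[y < θ]` for `y, θ ∈ [0, 1)`. [folklore] -/
theorem floor_sub_eq_neg_indicator {y θ : ℚ} (hy0 : 0 ≤ y) (hy1 : y < 1) (hθ0 : 0 ≤ θ) (hθ1 : θ < 1) :
    ⌊y - θ⌋ = -(if y < θ then 1 else 0 : ℤ) := by
  split_ifs with h
  · rw [Int.floor_eq_iff]; push_cast; constructor <;> linarith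
  · rw [Int.floor_eq_iff]; push_cast; constructor <;> linarith

/-- An indicator with non-negative weight is bounded below by any sufficient Boolean test. [folklore] -/
theorem ite_le_mul_indicator_of_nonneg {w : ℤ} (hw : 0 ≤ w) {P : Prop} [Decidable P] {b : Bool}
    (h : b = true → P) : (if b then w else 0) ≤ w * (if P then 1 else 0) := by
  cases b <;> by_cases hP : P <;> simp_all

/-- An indicator with non-positive weight is bounded below by any necessary Boolean test. [folklore] -/
theorem ite_le_mul_indicator_of_nonpos {w : ℤ} (hw : w ≤ 0) {P : Prop} [Decidable P] {b : Bool}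
    (h : P → b = true) : (if b then w else 0) ≤ w * (if P then 1 else 0) := by
  cases b <;> by_cases hP : P <;> simp_all

/-- The crude bound is sound on the closed cell. [folklore] -/
theorem crude_le (T : Term) {a0 a1 : ℤ} {b0 b1 : ℕ} {x y : ℚ} (hx0 : (a0 : ℚ) / b0 ≤ x)
    (hx1 : x ≤ (a1 : ℚ) / b1) (hy0 : 0 ≤ y) (hy1 : y < 1) : (prepTerm T a0 b0 a1 b1).crude ≤ T.eval x y := by
  have hr := affine_mem_of_le (α := (T.a : ℚ)) (β := 0) hx0 hx1
  simp only [add_zero] at hr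
  have e0 : (T.a : ℚ) * ((a0 : ℚ) / b0) = ((T.a * a0 : ℤ) : ℚ) / (b0 : ℕ) := by push_cast; ring
  have e1 : (T.a : ℚ) * ((a1 : ℚ) / b1) = ((T.a * a1 : ℤ) : ℚ) / (b1 : ℕ) := by push_cast; ring
  rw [e0, e1] at hr
  have hlo : (prepTerm T a0 b0 a1 b1).mlo ≤ ⌊(T.a : ℚ) * x⌋ := min_fl_le_floor hr.1
  have hhi : ⌊(T.a : ℚ) * x⌋ ≤ (prepTerm T a0 b0 a1 b1).mhi := by
    rcases le_max_iff.1 hr.2 with h | h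
    · exact (floor_le_fl h).trans (le_max_left _ _)
    · exact (floor_le_fl h).trans (le_max_right _ _)
  have hy : ⌊y⌋ = 0 := Int.floor_eq_zero_iff.2 ⟨hy0, hy1⟩
  have hyax_hi : ⌊y - (T.a : ℚ) * x⌋ ≤ -⌊(T.a : ℚ) * x⌋ := by
    have := Int.le_floor_add (y - (T.a : ℚ) * x) ((T.a : ℚ) * x)
    rw [sub_add_cancel, hy] at this; linarith
  have hyax_lo : -⌊(T.a : ℚ) * x⌋ - 1 ≤ ⌊y - (T.a : ℚ) * x⌋ := by
    have h1 := Int.le_floor_add y (-((T.a : ℚ) * x))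
    rw [hy, ← sub_eq_add_neg, Int.floor_neg] at h1
    have h2 := Int.ceil_le_floor_add_one ((T.a : ℚ) * x)
    linarith
  have haxy_hi : ⌊(T.a : ℚ) * x - y⌋ ≤ ⌊(T.a : ℚ) * x⌋ := Int.floor_le_floor (by linarith)
  have haxy_lo : ⌊(T.a : ℚ) * x⌋ - 1 ≤ ⌊(T.a : ℚ) * x - y⌋ := by
    have h1 := Int.le_floor_add ((T.a : ℚ) * x) (-y)
    have h2 : (-1 : ℤ) ≤ ⌊-y⌋ := Int.le_floor.2 (by push_cast; linarith)
    rw [← sub_eq_add_neg] at h1; linarith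
  set R := prepTerm T a0 b0 a1 b1 with hR
  have hcoef : R.coef = T.coef := rfl
  have hkind : R.kind = T.kind := rfl
  have h1 : -R.mhi - 1 ≤ ⌊y - (T.a : ℚ) * x⌋ := by linarith
  have h2 : ⌊y - (T.a : ℚ) * x⌋ ≤ -R.mlo := by linarith
  have h3 : R.mlo - 1 ≤ ⌊(T.a : ℚ) * x - y⌋ := by linarith
  have h4 : ⌊(T.a : ℚ) * x - y⌋ ≤ R.mhi := by linarith
  rcases T with ⟨c, kind, a⟩
  simp only at hcoef hkind hlo hhi h1 h2 h3 h4
  cases kind <;> simp only [TRec.crude, hkind, hcoef, Term.eval] <;> split_ifs with hc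
  · exact mul_le_mul_of_nonneg_left h1 hc
  · exact mul_le_mul_of_nonpos_left h2 (not_le.1 hc).le
  · exact mul_le_mul_of_nonneg_left h3 hc
  · exact mul_le_mul_of_nonpos_left h4 (not_le.1 hc).le
  · exact mul_le_mul_of_nonneg_left hlo hc
  · exact mul_le_mul_of_nonpos_left hhi (not_le.1 hc).le

/-- Per-term soundness of the piece bound in the floor-constant case. [folklore] -/
theorem pbOk_le (T : Term) {a0 a1 : ℤ} {b0 b1 : ℕ} (hb0 : 0 < b0) (hb1 : 0 < b1) {x y : ℚ}
    (hx0 : (a0 : ℚ) / b0 ≤ x) (hx1 : x < (a1 : ℚ) / b1) (hy0 : 0 ≤ y) (hy1 : y < 1)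
    (hok : (prepTerm T a0 b0 a1 b1).ok = true) {yk yk1 : QPt} (hdk : 0 < yk.d) (hdk1 : 0 < yk1.d)
    (hyk : yk.val ≤ y) (hyk1 : y < yk1.val) :
    (prepTerm T a0 b0 a1 b1).pbOk b0 b1 yk yk1 ≤ T.eval x y := by
  obtain ⟨hlo, hhi, hmin, hmax⟩ := prepTerm_spec T hb0 hb1 hx0 hx1 hok
  set R := prepTerm T a0 b0 a1 b1 with hR
  set θ : ℚ := (T.a : ℚ) * x - R.q with hθ
  have hθ0 : 0 ≤ θ := by rw [hθ]; linarith
  have hθ1 : θ < 1 := by rw [hθ]; linarith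
  have hcoef : R.coef = T.coef := rfl
  have hkind : R.kind = T.kind := rfl
  rcases T with ⟨c, kind, a⟩
  simp only at hcoef hkind hθ hlo hhi
  cases kind with
  | ax =>
    have hfl : ⌊(a : ℚ) * x⌋ = R.q := Int.floor_eq_iff.2 ⟨hlo, hhi⟩
    simp only [TRec.pbOk, hkind, Term.eval, hfl, hcoef]; exact le_rfl
  | yax =>
    have hval : Term.eval ⟨c, .yax, a⟩ x y = -(c * R.q) + (-c) * (if y < θ then 1 else 0 : ℤ) := by
      simp only [Term.eval]
      rw [show y - (a : ℚ) * x = (y - θ) - ((R.q : ℤ) : ℚ) by rw [hθ]; ring, Int.floor_sub_intCast,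
        floor_sub_eq_neg_indicator hy0 hy1 hθ0 hθ1]; ring
    rw [hval]; simp only [TRec.pbOk, hkind, hcoef]
    refine add_le_add le_rfl ?_
    by_cases hc : c ≤ 0
    · rw [if_pos hc]
      refine ite_le_mul_indicator_of_nonneg (by omega) fun h => ?_
      rw [Bool.and_eq_true, QPt.leR_iff _ _ hb0 hdk1, QPt.leR_iff _ _ hb1 hdk1] at h
      exact hyk1.trans_le ((le_min h.1 h.2).trans hmin)
    · rw [if_neg hc]
      refine ite_le_mul_indicator_of_nonpos (by omega) fun h => ?_
      by_contra hb
      rw [Bool.or_eq_true, QPt.ltR_iff _ _ hb0 hdk, QPt.ltR_iff _ _ hb1 hdk] at hb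
      rw [not_or, not_lt, not_lt] at hb
      exact absurd h (not_lt.2 ((hmax.trans (max_le hb.1 hb.2)).trans hyk))
  | axy =>
    have hval : Term.eval ⟨c, .axy, a⟩ x y = c * R.q + (-c) * (if θ < y then 1 else 0 : ℤ) := by
      simp only [Term.eval]
      rw [show (a : ℚ) * x - y = (θ - y) + ((R.q : ℤ) : ℚ) by rw [hθ]; ring, Int.floor_add_intCast,
        floor_sub_eq_neg_indicator hθ0 hθ1 hy0 hy1]; ring
    rw [hval]; simp only [TRec.pbOk, hkind, hcoef]
    refine add_le_add le_rfl ?_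
    by_cases hc : c ≤ 0
    · rw [if_pos hc]
      refine ite_le_mul_indicator_of_nonneg (by omega) fun h => ?_
      rw [Bool.and_eq_true, QPt.gtR_iff _ _ hb0 hdk, QPt.gtR_iff _ _ hb1 hdk] at h
      exact (hmax.trans_lt (max_lt h.1 h.2)).trans_le hyk
    · rw [if_neg hc]
      refine ite_le_mul_indicator_of_nonpos (by omega) fun h => ?_
      by_contra hb
      rw [Bool.or_eq_true, QPt.gtR_iff _ _ hb0 hdk1, QPt.gtR_iff _ _ hb1 hdk1] at hb
      rw [not_or, not_lt, not_lt] at hb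
      exact absurd h (not_lt.2 ((hyk1.le.trans (le_min hb.1 hb.2)).trans hmin))

/-- **Per-term soundness of the piece bound.** [folklore] -/
theorem pb_le (T : Term) {a0 a1 : ℤ} {b0 b1 : ℕ} (hb0 : 0 < b0) (hb1 : 0 < b1) {x y : ℚ}
    (hx0 : (a0 : ℚ) / b0 ≤ x) (hx1 : x < (a1 : ℚ) / b1) (hy0 : 0 ≤ y) (hy1 : y < 1)
    {yk yk1 : QPt} (hdk : 0 < yk.d) (hdk1 : 0 < yk1.d) (hyk : yk.val ≤ y) (hyk1 : y < yk1.val) :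
    (prepTerm T a0 b0 a1 b1).pb b0 b1 yk yk1 ≤ T.eval x y := by
  rw [TRec.pb]
  split_ifs with hok
  · exact pbOk_le T hb0 hb1 hx0 hx1 hy0 hy1 hok hdk hdk1 hyk hyk1
  · exact crude_le T hx0 hx1.le hy0 hy1

/-- Soundness of the piece bound for a term list. [folklore] -/
theorem piecePB_le (ts : List Term) {a0 a1 : ℤ} {b0 b1 : ℕ} (hb0 : 0 < b0) (hb1 : 0 < b1) {x y : ℚ}
    (hx0 : (a0 : ℚ) / b0 ≤ x) (hx1 : x < (a1 : ℚ) / b1) (hy0 : 0 ≤ y) (hy1 : y < 1)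
    {yk yk1 : QPt} (hdk : 0 < yk.d) (hdk1 : 0 < yk1.d) (hyk : yk.val ≤ y) (hyk1 : y < yk1.val) :
    piecePB (ts.map fun T => prepTerm T a0 b0 a1 b1) b0 b1 yk yk1 ≤ evalSum ts x y := by
  rw [piecePB, evalSum, List.map_map]
  exact sum_map_le_sum_map ts fun T _ => pb_le T hb0 hb1 hx0 hx1 hy0 hy1 hdk hdk1 hyk hyk1

/-- Soundness of the partition walk. [folklore] -/
theorem goS_sound (ts : List Term) {a0 a1 : ℤ} {b0 b1 : ℕ} (hb0 : 0 < b0) (hb1 : 0 < b1) {c : ℤ}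
    {x y : ℚ} (hx0 : (a0 : ℚ) / b0 ≤ x) (hx1 : x < (a1 : ℚ) / b1) (hy0 : 0 ≤ y) (hy1 : y < 1) :
    ∀ (ys : List QPt) (yk : QPt), 0 < yk.d → yk.val ≤ y →
      goS (ts.map fun T => prepTerm T a0 b0 a1 b1) b0 b1 c yk ys = true → c ≤ evalSum ts x y
  | [], yk, hdk, hyk, h => by
    simp only [goS, decide_eq_true_eq] at h
    have : (1 : ℚ) ≤ yk.val := by
      rw [QPt.val, le_div_iff₀ (by exact_mod_cast hdk), one_mul]; exact_mod_cast h
    linarith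
  | yk1 :: rest, yk, hdk, hyk, h => by
    simp only [goS, Bool.and_eq_true, decide_eq_true_eq] at h
    obtain ⟨⟨hdk1, hc⟩, hrest⟩ := h
    by_cases hy : y < yk1.val
    · exact hc.trans (piecePB_le ts hb0 hb1 hx0 hx1 hy0 hy1 hdk hdk1 hyk hy)
    · exact goS_sound ts hb0 hb1 hx0 hx1 hy0 hy1 rest yk1 hdk1 (not_lt.1 hy) hrest

/-- **Soundness of the sorted-threshold checker.** [folklore] -/
theorem checkS_sound {ts : List Term} {a0 a1 : ℤ} {b0 b1 : ℕ} {c : ℤ} {ys : List QPt}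
    (h : checkS ts a0 b0 a1 b1 c ys = true) {x y : ℚ} (hx0 : (a0 : ℚ) / b0 ≤ x)
    (hx1 : x < (a1 : ℚ) / b1) (hy0 : 0 ≤ y) (hy1 : y < 1) : c ≤ evalSum ts x y := by
  simp only [checkS, Bool.and_eq_true, decide_eq_true_eq] at h
  obtain ⟨⟨hb0, hb1⟩, hgo⟩ := h
  exact goS_sound ts hb0 hb1 hx0 hx1 hy0 hy1 ys ⟨0, 1⟩ Nat.one_pos (by simpa [QPt.val] using hy0) hgo

end SavingScan

open SavingCheck SavingScan

/-! ### Admissibility of a cell from a sorted-threshold certificate -/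

/-- The fast decidable admissibility check of a cell: the sorted-threshold checker for the term list on
`[u, v) × [0, 1)` with claimed bound `c`, along the given `y`-partition. [folklore] -/
def SavingCell.checkAdmS (ts : List Term) (C : SavingCell) (ys : List QPt) : Bool :=
  checkS ts C.u.num C.u.den C.v.num C.v.den (C.c : ℤ) ys

/-- **A cell that passes the sorted-threshold check is admissible** (`SavingCell.Adm`).
[cite: Lai2024BallRivoal, §4 Lemma 4.3] -/
theorem SavingCell.adm_of_checkAdmS (J r M : ℕ) (δ : Fin J → ℕ) (dmin : ℕ) (hδ : ∀ j, 2 * δ j ≤ M)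
    (C : SavingCell) (ys : List QPt) (h : C.checkAdmS (laiTerms J r M δ) ys = true) :
    C.Adm J r M δ dmin := by
  intro n p k _hp _hJ _hpn _hMn _hk1 _hk2 hmem
  rw [laiPhiDiv_eq_evalSum J r M n δ k p, laiTerms_evalSum_fract J r M δ hδ]
  rw [SavingCell.mem_iff] at hmem
  have hfx : Int.fract ((n : ℚ) / p) = ((n % p : ℕ) : ℚ) / p := Int.fract_div_natCast_eq_div_natCast_mod
  refine checkS_sound h ?_ ?_ (Int.fract_nonneg _) (Int.fract_lt_one _)
  · rw [Rat.num_div_den, hfx]; exact hmem.1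
  · rw [Rat.num_div_den, hfx]; exact hmem.2

end Summit.KontsevichZagierPeriods.Zeta5Search
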